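-- PORT: source=Summits/ABC/ABC/Theorems/IsogenyGlueCongruenceMazurKenkuBoundStubHauptmodulSeven.lean sha256=0a539072de7a32126db71536b324eee6d9b5b5beda06a3eae86b6924342c33d2 proposal=p173295 port=manual porter=bsd-cited-r19-g16
-- PORT: source=Summits/ABC/ABC/Theorems/IsogenyGlueCongruenceMazurKenkuBoundStubLevel49Endgame.lean sha256=cdc487210d9b831d88ac5c12bf9302a921080b1b7570238e8c462fa01725cf30 proposal=p173772 port=manual porter=bsd-cited-r19-g16
-- PORT: source=Summits/ABC/ABC/Theorems/IsogenyGlueCongruenceKenkuLevelFortyNine.lean sha256=4207c1108ea1eb5a0018d97a38537309389454eef29719241a91eef76832a9e8 proposal=p174220 port=manual porter=bsd-cited-r19-g16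
import Literature.NumberTheory.EllipticCurves.KenkuLevelFortyNineCoreProofs
import Literature.NumberTheory.EllipticCurves.CyclicIsogenyFortyNineMiddleCurveProofs
import Literature.NumberTheory.EllipticCurves.KubertSevenRigidityProofs
import Literature.NumberTheory.EllipticCurves.XZeroTwentyOneExplicit
import Literature.NumberTheory.EllipticCurves.XZeroFortyNineExplicit
import Literature.NumberTheory.EllipticCurves.Curve49A1Points
import HarnessLib

/-!
# Kenku's level `49`: no elliptic curve over `ℚ` has a rational cyclic `49`-isogeny
# (Kenku 1982, proof of Thm. 1, p. 200; Ligozat 1975: `X₀(49)(ℚ)` consists of the two cusps)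

Topic `NumberTheory/EllipticCurves`; a PROOFS file (theorems only, no `def`, no named fact; net
debt `0`). File 3 of 4 (part 2 of 2 of the glue, with the head theorem) of the `Literature/` PORT
of the tree's proved level-`49` theorem of Kenku — the `n = 49` leaf of Mazur's "First
reduction" (named fact `Literature.NumberTheory.EllipticCurves.Mazur1977_reduction_to_primes`) is
its corollary "no rational point of order `49`", file `KubertFortyNineProofs` (file 4 of 4).

PORT. Sources (PROVED, Summits-side, read-only here; sha256 of each in the `-- PORT:` lines 1–4):
* `Summits/ABC/ABC/Theorems/IsogenyGlueCongruenceMazurKenkuBoundStubLevelFortyNineGlue.lean`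
  (p174127), section "The glue over `ℚ`": `rat_sq_ne_neg_twentySeven` (a `[folklore]` in-file
  helper, declared `private` here because the `Literature/` lint `literature-cited-only` admits a
  bare `[folklore]` tag on private helpers only) and `stub_levelFortyNineGlue` ↦
  `levelFortyNineGlue`; part 1 (everything up to `levelFortyNine_core`) is the file
  `KenkuLevelFortyNineCoreProofs`;
* `Summits/ABC/ABC/Theorems/IsogenyGlueCongruenceMazurKenkuBoundStubHauptmodulSeven.lean`
  (p173295): `stub_hauptmodulSeven` ↦ `hauptmodulSeven` (a one-line wrapper of the tree's
  `WeierstrassCurve.hauptmodul_seven_of_torsion_some`, file `KleinFrickeLevelSevenTorsion`);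
* `Summits/ABC/ABC/Theorems/IsogenyGlueCongruenceMazurKenkuBoundStubLevel49Endgame.lean`
  (p173772): `stub_level49Endgame` ↦ `level49Endgame` (two lines over the tree's
  `XZeroFortyNine.exists_point_rat`, file `XZeroFortyNineExplicit`, and `Curve49A1.points`, file
  `Curve49A1Points`);
* `Summits/ABC/ABC/Theorems/IsogenyGlueCongruenceKenkuLevelFortyNine.lean` (p174220):
  `isogeny_isCyclic_degree_ne_fortyNine` (name and statement kept); its twin
  `kenkuLevelFortyNine_proof`, whose TYPE is the route declaration
  `Summit.ABC.ABC.Theses.IsogenyGlueCongruence.KenkuLevelFortyNine`, has no `Literature/`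
  counterpart — here the head theorem is obtained from `levelFortyNineGlue` applied to the four
  ported inputs directly.
Statements and tactic scripts VERBATIM, namespace `Summit.ABC.ABC.Theorems` ↦
`Literature.NumberTheory.EllipticCurves`, names unchanged except that the crux prefix `stub_` is
dropped; nothing is re-stated beyond that (a `Literature/` file may not import `Summits.*`,
CONVENTIONS §2); the Summits files are untouched. Ported by bsd-cited-r19 (ARM P lead ruling
(452)(a), OPS 2026-08-27T09:49Z).

WHAT. `levelFortyNineGlue`: no elliptic curve over `ℚ` admits a rational CYCLIC isogeny of degree
`49`, from the four inputs (A) `middleSeven` (file `CyclicIsogenyFortyNineMiddleCurveProofs`: the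
quotient `V₁ = V/⟨7P⟩` carries two distinct `Γ_ℚ`-stable cyclic subgroups `ℤP₁ ≠ ℤP₂` of order
`7`), (B) `hauptmodulSeven` (Klein–Fricke at `7` from a torsion point WITH the value `η` of the
Hauptmodul and Kubert's shape of the tangent-normalised coefficients), (C) `kubertSevenRigidity`
(file `KubertSevenRigidityProofs`: two Kubert normalisations of one equation with the same
Hauptmodul value differ by a multiple of the base point) and (D) `level49Endgame` (two distinct
nonzero rationals never share a value of `R₇(h) = (h²+13h+49)(h²+5h+1)³/h`: `X₀(49) ≅ 49a1` has
only its two rational cusps), all four stated as hypotheses of `levelFortyNineGlue` exactly as in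
the source and discharged by name in `isogeny_isCyclic_degree_ne_fortyNine`. The argument
(`X₀(49) ≅ X_sp(7)`) is `levelFortyNine_core` (file `KenkuLevelFortyNineCoreProofs`) over `ℚ`,
where `21` and `-27` are not squares and `u⁴ + 14u³ + 63u² + 70u - 7` has no root
(`XZeroTwentyOne.rat_sq_ne_twentyOne`, `rat_sq_ne_neg_twentySeven`,
`XZeroTwentyOne.rat_quartic_ne_zero`).

## References

* [Kenku1982] M. A. Kenku, *On the number of `ℚ`-isomorphism classes of elliptic curves in each
  `ℚ`-isogeny class*, J. Number Theory 15 (1982) 199–202, proof of Thm. 1, p. 200 (level `49`).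
* [Ligozat1975] G. Ligozat, *Courbes modulaires de genre 1*, Mém. SMF 43 (1975) (`X₀(49)`).
* [Kubert1976] D. S. Kubert, *Universal bounds on the torsion of elliptic curves*, Proc. London
  Math. Soc. (3) 33 (1976) 193–237, Table 3 (the form `E(b, c)` of `X₁(7)`).
* [CremonaAlgorithms1997] J. E. Cremona, *Algorithms for Modular Elliptic Curves*, 2nd ed.
  (1997), Table 1 (curve `49a1`).
* [SilvermanAEC2009] J. H. Silverman, *The Arithmetic of Elliptic Curves*, 2nd ed., GTM 106.
-/

noncomputable section

open scoped Classical

open WeierstrassCurve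

namespace Literature.NumberTheory.EllipticCurves

/-! ### Input (B): Klein–Fricke at level `7` from a torsion point, with the Hauptmodul value -/

/-- **Klein–Fricke at level `7` from a torsion point, with the value of the Hauptmodul.** For
`W/F` elliptic, `L/F` Galois and `P = (x, y) ∈ W(L)` of order `7` with `Gal(L/F)`-stable `ℤP`:
`A₂A₃(A₃ - A₁A₂) ≠ 0` for the tangent-normalised coefficients of `W_L` at `P`, which have
Kubert's shape `A₁ = u(1 - d(d-1))`, `A₂ = -u²d²(d-1)`, `A₃ = -u³d²(d-1)`
(`d = -A₂³/(A₃(A₃ - A₁A₂))`, `u = A₃/A₂`, `d(d-1) ≠ 0`), and some `η ∈ F` satisfies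
`j(W) · η = (η² + 13η + 49)(η² + 5η + 1)³` and `η · d(d-1) = d³ - 8d² + 5d + 1`. A thin
wrapper of the tree's `WeierstrassCurve.hauptmodul_seven_of_torsion_some` in the binder shape the
glue consumes; PORT of the Summits-side `Summit.ABC.ABC.Theorems.stub_hauptmodulSeven` (p173295),
statement verbatim. [cite: Kubert1976, Table 3 (N = 7)] -/
theorem hauptmodulSeven :
    ∀ {F : Type} [Field F] {L : Type} [Field L] [Algebra F L] [IsGalois F L]
      (W : WeierstrassCurve F) [W.IsElliptic] {x y : L}
      {h : (W.baseChange L).toAffine.Nonsingular x y},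
      addOrderOf (Affine.Point.some x y h : (W.baseChange L).toAffine.Point) = 7 →
      (∀ σ : L ≃ₐ[F] L, σ • (Affine.Point.some x y h : (W.baseChange L).toAffine.Point) ∈
          AddSubgroup.zmultiples (Affine.Point.some x y h : (W.baseChange L).toAffine.Point)) →
      (W.baseChange L).tgA₂ x y ≠ 0 ∧ (W.baseChange L).tgA₃ x y ≠ 0 ∧
      (W.baseChange L).tgA₃ x y - (W.baseChange L).tgA₁ x y * (W.baseChange L).tgA₂ x y ≠ 0 ∧
      ∀ d u : L,
        d = -(W.baseChange L).tgA₂ x y ^ 3 /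
              ((W.baseChange L).tgA₃ x y *
                ((W.baseChange L).tgA₃ x y - (W.baseChange L).tgA₁ x y * (W.baseChange L).tgA₂ x y)) →
        u = (W.baseChange L).tgA₃ x y / (W.baseChange L).tgA₂ x y →
        d ≠ 0 ∧ d - 1 ≠ 0 ∧
        (W.baseChange L).tgA₁ x y = u * (1 - d * (d - 1)) ∧
        (W.baseChange L).tgA₂ x y = -(u ^ 2 * (d ^ 2 * (d - 1))) ∧
        (W.baseChange L).tgA₃ x y = -(u ^ 3 * (d ^ 2 * (d - 1))) ∧
        ∃ η : F, W.j * η = (η ^ 2 + 13 * η + 49) * (η ^ 2 + 5 * η + 1) ^ 3 ∧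
          algebraMap F L η * (d * (d - 1)) = d ^ 3 - 8 * d ^ 2 + 5 * d + 1 := by
  intro F _ L _ _ _ W _ x y h h7 hσ
  exact hauptmodul_seven_of_torsion_some (W := W) h7 hσ

/-! ### Input (D): the Diophantine end (`X₀(49) ≅ 49a1`, `49a1(ℚ) = {O, (2, -1)}`) -/

/-- **Input (D) of the level-`49` glue, the Diophantine end**: two distinct nonzero rationals
`s ≠ t` cannot satisfy `P(s)t = P(t)s`, `P(h) = (h² + 13h + 49)(h² + 5h + 1)³` — the modular
curve `X₀(49) ≅ 49a1` has only its two rational cusps (the tree's explicit isomorphism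
`XZeroFortyNine.exists_point_rat` + Mordell–Weil of `49a1`, `Curve49A1.points`). The hypotheses
`s ≠ 0`, `t ≠ 0` are not needed. PORT of the Summits-side
`Summit.ABC.ABC.Theorems.stub_level49Endgame` (p173772), statement verbatim. [cite: Ligozat1975]
[cite: Kenku1982, proof of Thm. 1, p. 200] [cite: CremonaAlgorithms1997, Table 1 (49a1)] -/
theorem level49Endgame :
    ∀ s t : ℚ, s ≠ t → s ≠ 0 → t ≠ 0 →
      (s ^ 2 + 13 * s + 49) * (s ^ 2 + 5 * s + 1) ^ 3 * t =
        (t ^ 2 + 13 * t + 49) * (t ^ 2 + 5 * t + 1) ^ 3 * s → False := by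
  intro s t hst _ _ h
  obtain ⟨x, y, hW, hne⟩ := XZeroFortyNine.exists_point_rat hst h
  exact hne (Curve49A1.points x y hW)

/-! ### The glue over `ℚ` -/

/-- `-27` is not a rational square. [folklore] -/
private theorem rat_sq_ne_neg_twentySeven (u : ℚ) : u ^ 2 ≠ -27 := fun h ↦ by
  nlinarith [sq_nonneg u]

/-- **GLUE of the level-`49` line**: no rational cyclic `49`-isogeny, from the four inputs
`middleSeven`, `hauptmodulSeven`, `kubertSevenRigidity`, `level49Endgame` (statements inlined as
hypotheses, in this order). PORT of the Summits-side
`Summit.ABC.ABC.Theorems.stub_levelFortyNineGlue` (p174127), statement verbatim.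
[cite: Kenku1982, proof of Thm. 1, p. 200] [cite: Ligozat1975] [cite: Kubert1976, Table 3] -/
theorem levelFortyNineGlue :
    (∀ (V V' : WeierstrassCurve ℚ) [V.IsElliptic] [V'.IsElliptic] (ψ : Isogeny V V'),
      ψ.IsCyclic → ψ.degree = 49 →
      ∃ (V₁ : WeierstrassCurve ℚ) (_ : V₁.IsElliptic) (P₁ P₂ : V₁.geomPoints),
        addOrderOf P₁ = 7 ∧ addOrderOf P₂ = 7 ∧
        (∀ σ : Field.absoluteGaloisGroup ℚ, σ • P₁ ∈ AddSubgroup.zmultiples P₁) ∧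
        (∀ σ : Field.absoluteGaloisGroup ℚ, σ • P₂ ∈ AddSubgroup.zmultiples P₂) ∧
        P₂ ∉ AddSubgroup.zmultiples P₁) →
    (∀ {F : Type} [Field F] {L : Type} [Field L] [Algebra F L] [IsGalois F L]
      (W : WeierstrassCurve F) [W.IsElliptic] {x y : L}
      {h : (W.baseChange L).toAffine.Nonsingular x y},
      addOrderOf (Affine.Point.some x y h : (W.baseChange L).toAffine.Point) = 7 →
      (∀ σ : L ≃ₐ[F] L, σ • (Affine.Point.some x y h : (W.baseChange L).toAffine.Point) ∈
          AddSubgroup.zmultiples (Affine.Point.some x y h : (W.baseChange L).toAffine.Point)) →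
      (W.baseChange L).tgA₂ x y ≠ 0 ∧ (W.baseChange L).tgA₃ x y ≠ 0 ∧
      (W.baseChange L).tgA₃ x y - (W.baseChange L).tgA₁ x y * (W.baseChange L).tgA₂ x y ≠ 0 ∧
      ∀ d u : L,
        d = -(W.baseChange L).tgA₂ x y ^ 3 /
              ((W.baseChange L).tgA₃ x y *
                ((W.baseChange L).tgA₃ x y - (W.baseChange L).tgA₁ x y * (W.baseChange L).tgA₂ x y)) →
        u = (W.baseChange L).tgA₃ x y / (W.baseChange L).tgA₂ x y →
        d ≠ 0 ∧ d - 1 ≠ 0 ∧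
        (W.baseChange L).tgA₁ x y = u * (1 - d * (d - 1)) ∧
        (W.baseChange L).tgA₂ x y = -(u ^ 2 * (d ^ 2 * (d - 1))) ∧
        (W.baseChange L).tgA₃ x y = -(u ^ 3 * (d ^ 2 * (d - 1))) ∧
        ∃ η : F, W.j * η = (η ^ 2 + 13 * η + 49) * (η ^ 2 + 5 * η + 1) ^ 3 ∧
          algebraMap F L η * (d * (d - 1)) = d ^ 3 - 8 * d ^ 2 + 5 * d + 1) →
    (∀ {L : Type} [Field L] [CharZero L] (E : WeierstrassCurve L) (C C' : VariableChange L)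
      (u d u' d' : L),
      C.u = 1 → C'.u = 1 →
      (C • E).a₁ = u * (1 - d * (d - 1)) → (C • E).a₂ = -(u ^ 2 * (d ^ 2 * (d - 1))) →
      (C • E).a₃ = -(u ^ 3 * (d ^ 2 * (d - 1))) → (C • E).a₄ = 0 → (C • E).a₆ = 0 →
      (C' • E).a₁ = u' * (1 - d' * (d' - 1)) → (C' • E).a₂ = -(u' ^ 2 * (d' ^ 2 * (d' - 1))) →
      (C' • E).a₃ = -(u' ^ 3 * (d' ^ 2 * (d' - 1))) → (C' • E).a₄ = 0 → (C' • E).a₆ = 0 →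
      u ≠ 0 → u' ≠ 0 → d * (d - 1) ≠ 0 → d' * (d' - 1) ≠ 0 →
      (d ^ 3 - 8 * d ^ 2 + 5 * d + 1) * (d' * (d' - 1)) =
        (d' ^ 3 - 8 * d' ^ 2 + 5 * d' + 1) * (d * (d - 1)) →
      E.c₄ ≠ 0 → E.c₆ ≠ 0 →
      C'.r = C.r ∨ C'.r = C.r + u ^ 2 * (d ^ 2 * (d - 1)) ∨ C'.r = C.r + u ^ 2 * (d * (d - 1))) →
    (∀ s t : ℚ, s ≠ t → s ≠ 0 → t ≠ 0 →
      (s ^ 2 + 13 * s + 49) * (s ^ 2 + 5 * s + 1) ^ 3 * t =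
        (t ^ 2 + 13 * t + 49) * (t ^ 2 + 5 * t + 1) ^ 3 * s → False) →
    ∀ (V V' : WeierstrassCurve ℚ) [V.IsElliptic] [V'.IsElliptic] (ψ : Isogeny V V'),
      ψ.IsCyclic → ψ.degree ≠ 49 := by
  intro hA hB hC hD V V' _ _ ψ hψ h49
  obtain ⟨V₁, hV₁, P₁, P₂, ho₁, ho₂, hst₁, hst₂, hne⟩ := hA V V' ψ hψ h49
  haveI := hV₁
  obtain ⟨s, t, hst, hs0, ht0, h⟩ :=
    levelFortyNine_core XZeroTwentyOne.rat_sq_ne_twentyOne rat_sq_ne_neg_twentySeven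
      XZeroTwentyOne.rat_quartic_ne_zero hB hC V₁ P₁ P₂ ho₁ ho₂ hst₁ hst₂ hne
  exact hD s t hst hs0 ht0 h

/-! ### Kenku's level `49` -/

/-- **No rational cyclic `49`-isogeny (Kenku's level `49`).** No elliptic curve over `ℚ` admits a
`ℚ`-rational isogeny with cyclic kernel of order `49`: `X₀(49)(ℚ)` consists of its two cusps
(Ligozat 1975; Kenku 1982, proof of Thm. 1, p. 200, `X₀(49) ≅ X_sp(7)`), here modular-curve-free
as `levelFortyNineGlue` fed with the tree's four inputs `middleSeven`, `hauptmodulSeven`,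
`kubertSevenRigidity`, `level49Endgame`. PORT of the Summits-side
`Summit.ABC.ABC.Theorems.isogeny_isCyclic_degree_ne_fortyNine` /
`Summit.ABC.ABC.Theorems.kenkuLevelFortyNine_proof` (p174220), statement verbatim.
[cite: Kenku1982, proof of Thm. 1, p. 200] [cite: Ligozat1975] -/
theorem isogeny_isCyclic_degree_ne_fortyNine {V V' : WeierstrassCurve ℚ} [V.IsElliptic]
    [V'.IsElliptic] (ψ : Isogeny V V') (hψ : ψ.IsCyclic) : ψ.degree ≠ 49 :=
  levelFortyNineGlue middleSeven hauptmodulSeven kubertSevenRigidity level49Endgame V V' ψ hψ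

end Literature.NumberTheory.EllipticCurves

end
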